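import Summits.QuantumFields.YangMills.Theorems.BalabanUVNodesN15UnitLayerBgFamilyLetters
import Literature.MathematicalPhysics.QuantumFieldTheory.Balaban1983to89.Beta.BlockEffectiveAction
import Literature.MathematicalPhysics.QuantumFieldTheory.Balaban1983to89.B6Cov2156TorusDelK
import Literature.MathematicalPhysics.QuantumFieldTheory.Balaban1983to89.QGQInverse

/-!
# Route «BalabanUVNodes», cluster K4 «SpineRates» — node N15 = NE2, file V-A (dag-n15-a g17, programme V): BAŁABAN's (1.103)
# `(Q_kG_kQ_k*)⁻¹ = a_k + Δ_k` IN POSITION SPACE, IN THE REAL TwoGrid ∕ b06 BOND CURRENCY — `unitBondMat (Q G Q*) · (b·1 + deltaPol) = 1`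

Cell `pub-ymgap`, seat `pub-ymgap-dag-n15-a` (-a KNIT-BY-NAME seat of node N15; HUMAN RULING D-0062; chair R424 venue), generation 17, file V-A of programme V
(INBOX «DAGN15A-G17-INTENT-1»: the NON-LINEARISED (1.103) dressing of the U-seeing (2.156) unit layer of g16's U-D).  `bears_on: R4∕N15 · K3⁷
SpineGivenEndpointR13SepCoPH (stmt-QuantumFields-20544)`.  Filed `--kind proof --supports stmt-QuantumFields-20544 --as helper` — COUNT-NEUTRAL.  One data
`def` (`sOp` = `Q G Q*` on real unit-lattice 1-forms), the rest theorems; 0 `sorry`.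

WHY.  g16's U-D dresses THE (1.66) matrix `Δ_k = deltaPol M n` by the LINEARISATION `−Sym((b+Δ_k)Z(b+Δ_k))` of `Z ↦ ((b+Δ_k)⁻¹ + Z)⁻¹ − (b+Δ_k)`, citing the printed
(1.103) `(QGQ*)⁻¹ = a + Δ_k` as motivation only («not re-certified in position space»).  THE TREE HOLDS (1.103) AS AN OPERATOR IDENTITY (pub-balaban β cell:
`Beta.BlockEffectiveAction.QGQ_inv_eq : (QGQ n hn M a ha)⁻¹ = a•1 + DelK`, `Beta.FluctuationProjection.QGQ = QvOp * calG * QvAdj`, `B5DeltaA169.calG_eq_DeltaA_inv`,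
`B6Cov2156TorusDelK.deltaPol_eq_DelK`), in the COMPLEX `ℓ²(T_η)` matrix currency of [B5] §1.  This file transports it to the REAL currency of the TwoGrid lineage (parts
37∕39: `qvRe`, `qvAdjRe`, `gOp`) and of b06's (2.152)–(2.157) engine (`deltaPol M n` on the box bonds `B4.Idx (pbox M) (d+1)`, `unitBondMat` of U-C2): the unit-lattice
bond matrix of `Q_n G_n Q_n*` IS `(b·1 + Δ^{(n)})⁻¹` — so that V-B∕V-C can dress `Δ_k` by Bałaban's own non-linear map `E ↦ (Q E Q*)⁻¹ − b` applied to the operator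
layer's dressed propagator (g16 HANDOFF §g16.4 (b)).

WHAT (all on a unit torus `M : Fin (d+1) → ℕ`, fineness `n ≥ 1`, averaging constant `b > 0`).
* §1 `boxBondTor_eq_idxEquiv` (U-C2's bond dictionary IS b06∕β's `idxEquiv`, `rfl`), ★ `unitBondMat_eq_submatrix` (`unitBondMat M T = (toMatrix′ T).submatrix idxEquiv idxEquiv`),
  `unitBondMat_comp` (multiplicative), `unitBondMat_id`, `unitBondMat_add`, `unitBondMat_smul`, `unitBondMat_transpose_eq`.
* §2 the three operators as REAL PARTS of b05's complex matrices: ★ `toMatrix'_qvRe` (`= reM (QvOp n M)`), ★ `toMatrix'_qvAdjRe` (`= reM (QvAdj n M)`), ★ `toMatrix'_gOp`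
  (`= GR n M a = reM (DeltaA n M a)⁻¹`); def `sOp M n b := qvRe ∘ₗ gOp b ∘ₗ qvAdjRe` = `Q_n G_n Q_n*`; ★★ `toMatrix'_sOp` (`= reM (QGQ n hn M b hb)` — β's `QGQ*`).
* §3 ★★★ THE POSITION-SPACE (1.103) IN REAL BOND CURRENCY: `unitBondMat_sOp_eq` (`= (reM QGQ).submatrix e e`), `smul_one_add_deltaPol_eq` (`b•1 + deltaPol M n = (reM (QGQ)⁻¹).submatrix e e`),
  ★★★ **`unitBondMat_sOp_mul`** (`unitBondMat M (sOp M n b) * (b•1 + deltaPol M n) = 1`), ★★★ **`mul_unitBondMat_sOp`** (the other order), `isUnit_det_smul_one_add_deltaPol`,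
  `inv_smul_one_add_deltaPol` (`(b•1 + deltaPol M n)⁻¹ = unitBondMat M (sOp M n b)`), `inv_unitBondMat_sOp` (`(unitBondMat (Q G Q*))⁻¹ = b•1 + Δ^{(n)}` — (1.103) verbatim),
  `unitBondMat_sOp_isSymm`.
* §4 positivity letters for V-B (any dimension `e`, torus `N : Fin e → ℕ`): `form_deltaPol_nonneg` (`0 ≤ Bᵀ Δ^{(n)} B`, from β's `DelK_posSemidef`), ★ `coercive_smul_one_add_deltaPol`
  (`QGQInverse.Coercive (b•1 + Δ^{(n)}) b`).

HONEST FRAMING.  Count-neutral DICTIONARY work: every analytic∕algebraic input is a tree theorem consumed BY NAME (β cell: `QGQ_inv_eq`, `QGQ_mul_inv`, `QGQ_inv_mul`,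
`DelK_posSemidef`; b06: `deltaPol_eq_DelK`, `deltaPol_isSymm`; pv15: `IsReal` calculus; parts 37∕39: the three `…_ofReal` dictionaries); `U ≡ 1` linear theory on finite tori
(Bałaban's [B5] §1 setting); `Q = qvRe` is Bałaban's (1.18) averaging (real part) — in the CONSUMER (V-D) it acts on dag-n15-c's abelianised model species.  NOT [B9] at a
general `U`; N15 NOT discharged (typed 28∕28 · discharged 5∕27 of record unchanged); nothing continuum ∕ ℝ⁴ ∕ OS ∕ mass-gap ∕ Clay.  Restate-immune (no Theses import).
-/

set_option autoImplicit false

noncomputable section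

open scoped BigOperators Matrix ComplexOrder
open Finset

namespace Summit.QuantumFields.YangMills.BalabanUVNodes.N15.UnitLayerBg

open Literature.MathematicalPhysics.QuantumFieldTheory.Balaban1983to89
open Literature.MathematicalPhysics.QuantumFieldTheory.Balaban1983to89.B5Prop11Plancherel (Tor fine calG)
open Literature.MathematicalPhysics.QuantumFieldTheory.Balaban1983to89.B5RealFields (IsReal reM GR GR_map_ofReal isReal_QvOp isReal_QvAdj isReal_DeltaA_inv)
open Literature.MathematicalPhysics.QuantumFieldTheory.Balaban1983to89.B5DeltaA169 (QvAdj DeltaA calG_eq_DeltaA_inv)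
open Literature.MathematicalPhysics.QuantumFieldTheory.Balaban1983to89.B5Block118 (QvOp)
open Literature.MathematicalPhysics.QuantumFieldTheory.Balaban1983to89.B6Lemma24Torus (pbox)
open Literature.MathematicalPhysics.QuantumFieldTheory.Balaban1983to89.B6Cov2156Torus (deltaPol deltaPol_isSymm one_le_M)
open Literature.MathematicalPhysics.QuantumFieldTheory.Balaban1983to89.B6Cov2156TorusDelK (idxEquiv idxEquiv_apply deltaPol_eq_DelK DelK_eq_reindex_deltaPol)
open Literature.MathematicalPhysics.QuantumFieldTheory.Balaban1983to89.B6LowerBound2153Torus (toT)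
open Literature.MathematicalPhysics.QuantumFieldTheory.Balaban1983to89.Beta.FluctuationProjection (QGQ QGQ_mul_inv QGQ_inv_mul isUnit_QGQ_det)
open Literature.MathematicalPhysics.QuantumFieldTheory.Balaban1983to89.Beta.BlockEffectiveAction (DelK QGQ_inv_eq DelK_posSemidef)
open Summit.QuantumFields.YangMills.BalabanUVNodes.N15.TwoGrid (gOp qvRe qvAdjRe QvOp_mulVec_ofReal_re QvAdj_mulVec_ofReal_re DeltaA_inv_mulVec_ofReal)

variable {d : ℕ} (M : Fin (d + 1) → ℕ) [∀ μ, NeZero (M μ)]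

/-! ## §1 `unitBondMat` is the re-indexed matrix of the operator -/

section BondMatrix

/-- U-C2's box-bond ↦ torus-bond map IS b06∕β's `idxEquiv` (definitionally). [folklore] -/
theorem boxBondTor_eq_idxEquiv (p : B4.Idx (pbox M) (d + 1)) : boxBondTor M p = idxEquiv M p := rfl

/-- ★ `unitBondMat M T` is the standard matrix of `T` re-indexed along `idxEquiv` (box bonds ≃ torus bonds). [folklore] -/
theorem unitBondMat_eq_submatrix (T : (Tor M × Fin (d + 1) → ℝ) →ₗ[ℝ] (Tor M × Fin (d + 1) → ℝ)) :
    unitBondMat M T = (LinearMap.toMatrix' T).submatrix (idxEquiv M) (idxEquiv M) := rfl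

/-- `unitBondMat` is multiplicative. [folklore] -/
theorem unitBondMat_comp (T T' : (Tor M × Fin (d + 1) → ℝ) →ₗ[ℝ] (Tor M × Fin (d + 1) → ℝ)) :
    unitBondMat M (T ∘ₗ T') = unitBondMat M T * unitBondMat M T' := by
  rw [unitBondMat_eq_submatrix, unitBondMat_eq_submatrix, unitBondMat_eq_submatrix, LinearMap.toMatrix'_comp, Matrix.submatrix_mul_equiv]

/-- `unitBondMat id = 1`. [folklore] -/
theorem unitBondMat_id : unitBondMat M (LinearMap.id : (Tor M × Fin (d + 1) → ℝ) →ₗ[ℝ] (Tor M × Fin (d + 1) → ℝ)) = 1 := by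
  rw [unitBondMat_eq_submatrix, LinearMap.toMatrix'_id, Matrix.submatrix_one_equiv]

/-- additivity. [folklore] -/
theorem unitBondMat_add (T T' : (Tor M × Fin (d + 1) → ℝ) →ₗ[ℝ] (Tor M × Fin (d + 1) → ℝ)) :
    unitBondMat M (T + T') = unitBondMat M T + unitBondMat M T' := by
  rw [unitBondMat_eq_submatrix, unitBondMat_eq_submatrix, unitBondMat_eq_submatrix, map_add, Matrix.submatrix_add]
  rfl

/-- homogeneity. [folklore] -/
theorem unitBondMat_smul (c : ℝ) (T : (Tor M × Fin (d + 1) → ℝ) →ₗ[ℝ] (Tor M × Fin (d + 1) → ℝ)) :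
    unitBondMat M (c • T) = c • unitBondMat M T := by
  rw [unitBondMat_eq_submatrix, unitBondMat_eq_submatrix, map_smul, Matrix.submatrix_smul]
  rfl

end BondMatrix

/-! ## §2 The three TwoGrid operators are the real parts of b05's complex matrices -/

section RealParts

variable (n : ℕ) [NeZero n]

omit [∀ μ, NeZero (M μ)] in
/-- The real point mass read in ℂ is the complex point mass. [folklore] -/
theorem ofReal_single {ι : Type} [DecidableEq ι] (x : ι) :
    (fun i => (((Pi.single x (1 : ℝ) : ι → ℝ) i : ℝ) : ℂ)) = Pi.single x (1 : ℂ) := by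
  funext i
  by_cases h : i = x
  · subst h; simp
  · simp [h]

/-- ★ `Q_n` on real 1-forms IS `Re QvOp` as a matrix (part 37's `QvOp_mulVec_ofReal_re` on point masses). [cite: Balaban1984PropagatorsI, (1.18) p.20] -/
theorem toMatrix'_qvRe : LinearMap.toMatrix' (qvRe M n) = reM (QvOp n M) := by
  ext b x
  rw [LinearMap.toMatrix'_apply, B5RealFields.reM_apply, ← QvOp_mulVec_ofReal_re, ofReal_single, Matrix.mulVec_single_one, Matrix.col_apply]

/-- ★ `Q_n*` on real 1-forms IS `Re QvAdj` as a matrix (part 37's `QvAdj_mulVec_ofReal_re`). [cite: Balaban1984PropagatorsI, (1.18) p.20] -/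
theorem toMatrix'_qvAdjRe : LinearMap.toMatrix' (qvAdjRe M n) = reM (QvAdj n M) := by
  ext i b
  rw [LinearMap.toMatrix'_apply, B5RealFields.reM_apply, ← QvAdj_mulVec_ofReal_re, ofReal_single, Matrix.mulVec_single_one, Matrix.col_apply]

/-- ★ `G = Δ_a⁻¹` on real 1-forms IS `GR = Re (DeltaA)⁻¹` as a matrix (part 39: `gOp = mulVecLin GR`). [cite: Balaban1984PropagatorsI, (1.71) p.30] -/
theorem toMatrix'_gOp (a : ℝ) : LinearMap.toMatrix' (gOp M n a) = GR n M a := by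
  show LinearMap.toMatrix' (Matrix.toLin' (GR n M a)) = GR n M a
  exact LinearMap.toMatrix'_toLin' _

/-- **`Q_n G_n Q_n*`** — Bałaban's block-averaged full `U ≡ 1` Landau-gauge propagator on REAL unit-lattice 1-forms: `qvRe ∘ gOp ∘ qvAdjRe` (parts 37∕39). [cite: Balaban1984PropagatorsI, (1.99)–(1.102) p.34 (object `QGQ*`)] -/
def sOp (b : ℝ) : (Tor M × Fin (d + 1) → ℝ) →ₗ[ℝ] (Tor M × Fin (d + 1) → ℝ) :=
  qvRe M n ∘ₗ (gOp M n b ∘ₗ qvAdjRe M n)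

/-- unfolding. [folklore] -/
theorem sOp_def (b : ℝ) : sOp M n b = qvRe M n ∘ₗ (gOp M n b ∘ₗ qvAdjRe M n) := rfl

/-- ★★ THE MATRIX OF `Q_n G_n Q_n*` IS THE REAL PART OF β's `QGQ n hn M b hb = QvOp * calG * QvAdj` (`calG = DeltaA⁻¹`, all three factors real). [cite: Balaban1984PropagatorsI, (1.99) p.34] -/
theorem toMatrix'_sOp (hn : 1 ≤ n) {b : ℝ} (hb : 0 < b) : LinearMap.toMatrix' (sOp M n b) = reM (QGQ n hn M b hb) := by
  rw [sOp_def, LinearMap.toMatrix'_comp, LinearMap.toMatrix'_comp, toMatrix'_qvRe, toMatrix'_gOp, toMatrix'_qvAdjRe, QGQ, calG_eq_DeltaA_inv, GR,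
    ← (isReal_DeltaA_inv n M b).reM_mul (isReal_QvAdj n M), ← (isReal_QvOp n M).reM_mul ((isReal_DeltaA_inv n M b).mul (isReal_QvAdj n M)), Matrix.mul_assoc]

/-- `QGQ*` is a real matrix. [folklore] -/
theorem isReal_QGQ (hn : 1 ≤ n) {b : ℝ} (hb : 0 < b) : IsReal (QGQ n hn M b hb) := by
  unfold QGQ
  rw [calG_eq_DeltaA_inv]
  exact ((isReal_QvOp n M).mul (isReal_DeltaA_inv n M b)).mul (isReal_QvAdj n M)

end RealParts

/-! ## §3 (1.103) in position space, in the real bond currency: `unitBondMat (Q G Q*) · (b·1 + deltaPol) = 1` -/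

section Eq1103

variable (n : ℕ) [NeZero n]

/-- `unitBondMat M (Q_n G_n Q_n*) = (Re QGQ*) re-indexed by idxEquiv`. [cite: Balaban1984PropagatorsI, (1.99) p.34] -/
theorem unitBondMat_sOp_eq (hn : 1 ≤ n) {b : ℝ} (hb : 0 < b) :
    unitBondMat M (sOp M n b) = (reM (QGQ n hn M b hb)).submatrix (idxEquiv M) (idxEquiv M) := by
  rw [unitBondMat_eq_submatrix, toMatrix'_sOp M n hn hb]

/-- `b·1 + Δ^{(n)} = (Re (QGQ*)⁻¹) re-indexed by idxEquiv` — β's `QGQ_inv_eq` + b06's `deltaPol_eq_DelK`. [cite: Balaban1984PropagatorsI, (1.102)–(1.103) p.34, (1.65)–(1.66) p.29] -/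
theorem smul_one_add_deltaPol_eq (hn : 1 ≤ n) {b : ℝ} (hb : 0 < b) :
    b • (1 : Matrix (B4.Idx (pbox M) (d + 1)) (B4.Idx (pbox M) (d + 1)) ℝ) + deltaPol M n = (reM (QGQ n hn M b hb)⁻¹).submatrix (idxEquiv M) (idxEquiv M) := by
  ext p q
  rw [Matrix.submatrix_apply, B5RealFields.reM_apply, QGQ_inv_eq, Matrix.add_apply, Matrix.add_apply, Matrix.smul_apply, Matrix.smul_apply, Complex.add_re,
    smul_eq_mul, smul_eq_mul, Complex.mul_re, Complex.ofReal_re, Complex.ofReal_im, zero_mul, sub_zero]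
  congr 1
  · by_cases h : p = q
    · subst h; simp
    · have h' : idxEquiv M p ≠ idxEquiv M q := fun e => h ((idxEquiv M).injective e)
      simp [Matrix.one_apply_ne h, Matrix.one_apply_ne h']
  · rw [← deltaPol_eq_DelK n hn M b hb p q, Complex.ofReal_re]

/-- ★★★ **(1.103) IN POSITION SPACE, REAL BOND CURRENCY: `unitBondMat (Q_n G_n Q_n*) · (b·1 + Δ^{(n)}) = 1`.** [cite: Balaban1984PropagatorsI, (1.102)–(1.103) p.34] -/
theorem unitBondMat_sOp_mul (hn : 1 ≤ n) {b : ℝ} (hb : 0 < b) :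
    unitBondMat M (sOp M n b) * (b • (1 : Matrix (B4.Idx (pbox M) (d + 1)) (B4.Idx (pbox M) (d + 1)) ℝ) + deltaPol M n) = 1 := by
  rw [unitBondMat_sOp_eq M n hn hb, smul_one_add_deltaPol_eq M n hn hb, Matrix.submatrix_mul_equiv,
    ← (isReal_QGQ M n hn hb).reM_mul (isReal_QGQ M n hn hb).inv, QGQ_mul_inv, B5RealFields.reM_one, Matrix.submatrix_one_equiv]

/-- ★★★ **… and `(b·1 + Δ^{(n)}) · unitBondMat (Q_n G_n Q_n*) = 1`.** [cite: Balaban1984PropagatorsI, (1.102)–(1.103) p.34] -/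
theorem mul_unitBondMat_sOp (hn : 1 ≤ n) {b : ℝ} (hb : 0 < b) :
    (b • (1 : Matrix (B4.Idx (pbox M) (d + 1)) (B4.Idx (pbox M) (d + 1)) ℝ) + deltaPol M n) * unitBondMat M (sOp M n b) = 1 := by
  rw [unitBondMat_sOp_eq M n hn hb, smul_one_add_deltaPol_eq M n hn hb, Matrix.submatrix_mul_equiv,
    ← (isReal_QGQ M n hn hb).inv.reM_mul (isReal_QGQ M n hn hb), QGQ_inv_mul, B5RealFields.reM_one, Matrix.submatrix_one_equiv]

/-- `det (b·1 + Δ^{(n)})` is a unit. [folklore] -/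
theorem isUnit_det_smul_one_add_deltaPol (hn : 1 ≤ n) {b : ℝ} (hb : 0 < b) :
    IsUnit (b • (1 : Matrix (B4.Idx (pbox M) (d + 1)) (B4.Idx (pbox M) (d + 1)) ℝ) + deltaPol M n).det :=
  Matrix.isUnit_det_of_right_inverse (mul_unitBondMat_sOp M n hn hb)

/-- `det (unitBondMat (Q G Q*))` is a unit. [folklore] -/
theorem isUnit_det_unitBondMat_sOp (hn : 1 ≤ n) {b : ℝ} (hb : 0 < b) : IsUnit (unitBondMat M (sOp M n b)).det :=
  Matrix.isUnit_det_of_right_inverse (unitBondMat_sOp_mul M n hn hb)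

/-- `(b·1 + Δ^{(n)})⁻¹ = unitBondMat (Q_n G_n Q_n*)`. [cite: Balaban1984PropagatorsI, (1.102)–(1.103) p.34] -/
theorem inv_smul_one_add_deltaPol (hn : 1 ≤ n) {b : ℝ} (hb : 0 < b) :
    (b • (1 : Matrix (B4.Idx (pbox M) (d + 1)) (B4.Idx (pbox M) (d + 1)) ℝ) + deltaPol M n)⁻¹ = unitBondMat M (sOp M n b) :=
  Matrix.inv_eq_right_inv (mul_unitBondMat_sOp M n hn hb)

/-- **(1.103) VERBATIM: `(unitBondMat (Q_n G_n Q_n*))⁻¹ = b·1 + Δ^{(n)}`** — the inverse of the block-averaged propagator is the averaging constant plus THE (1.66) matrix.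
[cite: Balaban1984PropagatorsI, (1.102)–(1.103) p.34] -/
theorem inv_unitBondMat_sOp (hn : 1 ≤ n) {b : ℝ} (hb : 0 < b) :
    (unitBondMat M (sOp M n b))⁻¹ = b • (1 : Matrix (B4.Idx (pbox M) (d + 1)) (B4.Idx (pbox M) (d + 1)) ℝ) + deltaPol M n :=
  Matrix.inv_eq_right_inv (unitBondMat_sOp_mul M n hn hb)

/-- `unitBondMat (Q G Q*)` is symmetric (inverse of the symmetric `b·1 + Δ^{(n)}`). [folklore] -/
theorem unitBondMat_sOp_isSymm (hn : 1 ≤ n) {b : ℝ} (hb : 0 < b) : (unitBondMat M (sOp M n b)).IsSymm := by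
  rw [← inv_smul_one_add_deltaPol M n hn hb]
  have hs : (b • (1 : Matrix (B4.Idx (pbox M) (d + 1)) (B4.Idx (pbox M) (d + 1)) ℝ) + deltaPol M n).IsSymm :=
    (Matrix.isSymm_one.smul b).add (deltaPol_isSymm M n)
  exact hs.inv

end Eq1103

/-! ## §4 Positivity letters for the exact dressing (V-B), any dimension: `Δ^{(n)} ≥ 0`, `b·1 + Δ^{(n)}` is `b`-coercive -/

section Positivity

variable {e : ℕ} (N : Fin e → ℕ) [∀ μ, NeZero (N μ)] (n : ℕ) [NeZero n]

/-- `0 ≤ Bᵀ·Δ^{(n)}·B` for every REAL bond field `B` (β's `DelK_posSemidef` through `DelK_eq_reindex_deltaPol`). [cite: Balaban1984PropagatorsI, (1.65) p.29 (`Δ_k ≥ 0`)] -/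
theorem form_deltaPol_nonneg (hn : 1 ≤ n) (B : B4.Idx (pbox N) e → ℝ) : 0 ≤ B ⬝ᵥ (deltaPol N n *ᵥ B) := by
  -- read B in ℂ on the torus bonds
  set X : Tor N × Fin e → ℂ := fun s => ((B ((idxEquiv N).symm s) : ℝ) : ℂ) with hX
  have hpsd := (DelK_posSemidef n hn N 1 one_pos).dotProduct_mulVec_nonneg X
  rw [DelK_eq_reindex_deltaPol n hn N 1 one_pos] at hpsd
  -- the complex form equals the real form
  have key : star X ⬝ᵥ ((((deltaPol N n).reindex (idxEquiv N) (idxEquiv N)).map ((↑) : ℝ → ℂ)) *ᵥ X) = ((B ⬝ᵥ (deltaPol N n *ᵥ B) : ℝ) : ℂ) := by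
    simp only [dotProduct, Matrix.mulVec, Matrix.map_apply, Matrix.reindex_apply, Matrix.submatrix_apply, hX, Pi.star_apply, Complex.star_def, Complex.conj_ofReal,
      Complex.ofReal_sum, Complex.ofReal_mul]
    rw [← (idxEquiv N).sum_comp]
    refine Finset.sum_congr rfl fun p _ => ?_
    rw [Equiv.symm_apply_apply, ← (idxEquiv N).sum_comp]
    refine congrArg _ (Finset.sum_congr rfl fun q _ => ?_)
    rw [Equiv.symm_apply_apply]
  rw [key] at hpsd
  exact_mod_cast (Complex.zero_le_real.mp hpsd)

/-- ★ `b·1 + Δ^{(n)}` IS `b`-COERCIVE: `b‖B‖² ≤ Bᵀ(b·1 + Δ^{(n)})B`. [folklore] -/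
theorem coercive_smul_one_add_deltaPol (hn : 1 ≤ n) (b : ℝ) :
    QGQInverse.Coercive (b • (1 : Matrix (B4.Idx (pbox N) e) (B4.Idx (pbox N) e) ℝ) + deltaPol N n) b := by
  intro B
  have h := form_deltaPol_nonneg N n hn B
  rw [Matrix.add_mulVec, dotProduct_add, Matrix.smul_mulVec, Matrix.one_mulVec, dotProduct_smul, smul_eq_mul]
  linarith

end Positivity

end Summit.QuantumFields.YangMills.BalabanUVNodes.N15.UnitLayerBg

end
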